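import Mathlib
import HarnessLib
import Literature.MathematicalPhysics.StatisticalMechanics.StepMeasureRegularisation
import Literature.MathematicalPhysics.QuantumFieldTheory.GaussianCovarianceComparison

/-!
# Change of the quadratic form of the torus Gaussian: `μ^{(A)}` versus `μ^{(A')}` on gradient
# functionals ([ABKM19] Ch. 4.2 (4.5)–(4.8), Definition 6.5: the family `μ^{(q)}`)

[ABKM19] runs the renormalisation group for the perturbed measure `∫ F dμ^{(0)}` with the Gaussian
`μ^{(q)}` of the quadratic form `½ Σ_x ⟨(𝟙+q)∇φ(x), ∇φ(x)⟩` chosen by the fine tuning of Ch. 12, via the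
elementary identity (4.5)–(4.8): `μ^{(0)}(dφ) = (Z^{(q)}/Z^{(0)}) · e^{½ Σ_x ⟨q∇φ(x), ∇φ(x)⟩} μ^{(q)}(dφ)` on
zero-average fields.  In the tree the Gaussian of the coefficient matrix `A` lives on ALL fields as the
degenerate measure `stepMeasure 𝒞 = N(0, circulant 𝒞)` of the total kernel `𝒞 = Σ_k 𝒞_{A,k}` of the
finite-range decomposition (`GradientFRD.TorusFRD` (o)–(ii): `Σ_x 𝒞(x) = 0`, `circulant 𝒞 ⪰ 0`,
`∇*A∇ (𝒞 ⋆ φ) = φ` for zero-average `φ`), and gradient functionals are the shift-invariant ones.  This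
file proves the identity in that language, for general dimension `d`:

* `fwdMat i`, `ellMat A` — the matrices of `∇_i` and of `∇*A∇ = Σ_{ij} A_{ij} ∇_i^*∇_j` (`ellMat_mulVec`:
  `ellMat A · φ = ellOp A φ`; `dotProduct_ellMat_mulVec`: `⟨φ, ellMat A φ⟩ = Σ_x Σ_{ij} A_{ij}∇_iφ(x)∇_jφ(x)`);
* `ellMat_mul_circulant`, `circulant_mul_ellMat` — `(∇*A∇)·circulant 𝒞 = circulant 𝒞·(∇*A∇) = 1 − 𝟙𝟙ᵀ/|Λ|`;
  **`inv_circulant_add_constMat`** — `(circulant 𝒞 + c𝟙𝟙ᵀ)⁻¹ = ∇*A∇ + 𝟙𝟙ᵀ/(c|Λ|²)` (`c ≠ 0`), and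
  **`posDef_circulant_add_constMat_of_inv`** (`c > 0`): the zero-mode regularisation of the Green's function is a
  bona fide covariance whose precision is the elliptic operator plus a zero-mode mass;
* **`integral_stepMeasure_eq_formChange`** — for symmetric `A, A'`, kernels `𝒞, 𝒞'` as above, and a
  strongly measurable shift-invariant `F`:
  `∫ F d(stepMeasure 𝒞) = κ_{A,A'} • ∫ e^{½ Σ_x Σ_{ij} (A'−A)_{ij} ∇_iφ(x)∇_jφ(x)} • F(φ) d(stepMeasure 𝒞')`,
  with `κ_{A,A'} = formChangeConst A A' > 0` (`formChangeConst_pos`) INDEPENDENT of `F` and of the kernels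
  (a ratio of Gaussian normalisations of the two precisions).  Proof: zero-mode regularisation
  (`integral_stepMeasure_eq_integral_multivariateGaussian_add_constMat`), the density ratio of two
  non-degenerate Gaussians (`gaussRatio`), and the explicit precisions.

Everything is proved; no named fact.

## References
* S. Adams, S. Buchholz, R. Kotecký, S. Müller, arXiv:1910.13564, Ch. 4.2 (4.5)–(4.8), Ch. 6.1,
  Definition 6.5 [AdamsBuchholzKoteckyMuller2019].
-/

noncomputable section

namespace Literature.MathematicalPhysics.StatisticalMechanics.GradientRG

open scoped BigOperators Matrix
open MeasureTheory ProbabilityTheory Finset WithLp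
open Literature.MathematicalPhysics.StatisticalMechanics.GradientFRD (ellOp)
open Literature.MathematicalPhysics.QuantumFieldTheory
  (gaussRatio measurable_gaussRatio multivariateGaussian_eq_withDensity_gaussRatio toReal_gaussRatio)
open Literature.MathematicalPhysics.QuantumFieldTheory.GaussianToolkit (gaussZ multivariateGaussian_eq_withDensity)

variable {d M : ℕ} [NeZero M]

/-! ## The matrices of `∇_i` and of `∇*A∇` -/

/-- The matrix of the forward derivative `∇_i` on `Λ = (ℤ/M)^d`: `(∇_iφ)(s) = φ(s + e_i) − φ(s)`.
[cite: AdamsBuchholzKoteckyMuller2019, Ch. 6.1 (forward derivatives)] -/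
def fwdMat (i : Fin d) : Matrix (Fin d → ZMod M) (Fin d → ZMod M) ℝ :=
  fun s t => (if t = s + Pi.single i 1 then (1 : ℝ) else 0) - (if t = s then (1 : ℝ) else 0)

/-- `fwdMat i · φ = ∇_iφ`. [cite: AdamsBuchholzKoteckyMuller2019, Ch. 6.1 (forward derivatives)] -/
theorem fwdMat_mulVec (i : Fin d) (φ : (Fin d → ZMod M) → ℝ) : fwdMat i *ᵥ φ = GradientFRD.fwdDiff i φ := by
  funext s
  simp only [Matrix.mulVec, dotProduct, fwdMat, sub_mul, ite_mul, one_mul, zero_mul,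
    Finset.sum_sub_distrib, Finset.sum_ite_eq', Finset.mem_univ, if_true, GradientFRD.fwdDiff]

/-- `(fwdMat i)ᵀ · φ = ∇_i^*φ` (`(∇_i^*φ)(s) = φ(s − e_i) − φ(s)`). [cite: AdamsBuchholzKoteckyMuller2019, Ch. 6.1 (forward derivatives)] -/
theorem fwdMat_transpose_mulVec (i : Fin d) (φ : (Fin d → ZMod M) → ℝ) :
    (fwdMat i)ᵀ *ᵥ φ = GradientFRD.bwdDiff i φ := by
  funext s
  simp only [Matrix.mulVec, dotProduct, Matrix.transpose_apply, fwdMat, sub_mul, ite_mul, one_mul,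
    zero_mul, Finset.sum_sub_distrib]
  have h1 : ∑ t : Fin d → ZMod M, (if s = t + Pi.single i 1 then φ t else 0) = φ (s - Pi.single i 1) := by
    have : ∀ t : Fin d → ZMod M, (s = t + Pi.single i 1) = (t = s - Pi.single i 1) := fun t =>
      propext ⟨fun h => by rw [h, add_sub_cancel_right], fun h => by rw [h, sub_add_cancel]⟩
    simp_rw [this]
    rw [Finset.sum_ite_eq' Finset.univ (s - Pi.single i 1)]
    simp
  have h2 : ∑ t : Fin d → ZMod M, (if s = t then φ t else 0) = φ s := by
    rw [Finset.sum_ite_eq Finset.univ s]; simp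
  rw [h1, h2]
  rfl

/-- **The matrix of the elliptic operator** `∇*A∇ = Σ_{i,j} A_{ij} ∇_i^* ∇_j`.
[cite: AdamsBuchholzKoteckyMuller2019, Ch. 6.1 (the operator 𝒜^{(q)})] -/
def ellMat (A : Matrix (Fin d) (Fin d) ℝ) : Matrix (Fin d → ZMod M) (Fin d → ZMod M) ℝ :=
  ∑ i : Fin d, ∑ j : Fin d, A i j • ((fwdMat i)ᵀ * fwdMat j)

/-- `ellMat A · φ = 𝒜_A φ` (the tree's `GradientFRD.ellOp`). [cite: AdamsBuchholzKoteckyMuller2019, Ch. 6.1 (the operator 𝒜^{(q)})] -/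
theorem ellMat_mulVec (A : Matrix (Fin d) (Fin d) ℝ) (φ : (Fin d → ZMod M) → ℝ) :
    ellMat A *ᵥ φ = ellOp A φ := by
  funext x
  rw [ellMat, Matrix.sum_mulVec, Finset.sum_apply]
  unfold ellOp
  refine Finset.sum_congr rfl fun i _ => ?_
  rw [Matrix.sum_mulVec, Finset.sum_apply]
  refine Finset.sum_congr rfl fun j _ => ?_
  rw [Matrix.smul_mulVec, ← Matrix.mulVec_mulVec, fwdMat_mulVec, fwdMat_transpose_mulVec]
  rfl

/-- `⟨φ, ellMat A φ⟩ = Σ_x Σ_{i,j} A_{ij} ∇_iφ(x) ∇_jφ(x)`. [cite: AdamsBuchholzKoteckyMuller2019, Ch. 4.2 (4.5)] -/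
theorem dotProduct_ellMat_mulVec (A : Matrix (Fin d) (Fin d) ℝ) (φ : (Fin d → ZMod M) → ℝ) :
    φ ⬝ᵥ ellMat A *ᵥ φ = ∑ x, ∑ i, ∑ j, A i j * GradientFRD.fwdDiff i φ x * GradientFRD.fwdDiff j φ x := by
  rw [ellMat, Matrix.sum_mulVec, dotProduct_sum]
  have h : ∀ i, φ ⬝ᵥ (∑ j, A i j • ((fwdMat i)ᵀ * fwdMat j)) *ᵥ φ =
      ∑ x, ∑ j, A i j * GradientFRD.fwdDiff i φ x * GradientFRD.fwdDiff j φ x := by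
    intro i
    rw [Matrix.sum_mulVec, dotProduct_sum]
    have h' : ∀ j, φ ⬝ᵥ (A i j • ((fwdMat i)ᵀ * fwdMat j)) *ᵥ φ = ∑ x, A i j * GradientFRD.fwdDiff i φ x * GradientFRD.fwdDiff j φ x := by
      intro j
      rw [Matrix.smul_mulVec, ← Matrix.mulVec_mulVec, dotProduct_smul, Matrix.dotProduct_mulVec,
        Matrix.vecMul_transpose, fwdMat_mulVec, fwdMat_mulVec, smul_eq_mul, dotProduct, Finset.mul_sum]
      refine Finset.sum_congr rfl fun x _ => ?_
      ring
    simp_rw [h']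
    rw [Finset.sum_comm]
  simp_rw [h]
  rw [Finset.sum_comm]

/-- `ellMat` is linear in the coefficient matrix: `ellMat A' − ellMat A = ellMat (A' − A)`.
[cite: AdamsBuchholzKoteckyMuller2019, Ch. 4.2 (4.5)] -/
theorem ellMat_sub (A A' : Matrix (Fin d) (Fin d) ℝ) :
    ellMat (M := M) A' - ellMat A = ellMat (A' - A) := by
  unfold ellMat
  rw [← Finset.sum_sub_distrib]
  refine Finset.sum_congr rfl fun i _ => ?_
  rw [← Finset.sum_sub_distrib]
  refine Finset.sum_congr rfl fun j _ => ?_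
  rw [Matrix.sub_apply, sub_smul]

/-- `ellMat A` is symmetric for symmetric `A`. [cite: AdamsBuchholzKoteckyMuller2019, Ch. 6.1 (the operator 𝒜^{(q)})] -/
theorem ellMat_transpose {A : Matrix (Fin d) (Fin d) ℝ} (hA : A.IsSymm) : (ellMat (M := M) A)ᵀ = ellMat A := by
  unfold ellMat
  rw [Matrix.transpose_sum]
  simp_rw [Matrix.transpose_sum, Matrix.transpose_smul, Matrix.transpose_mul, Matrix.transpose_transpose]
  rw [Finset.sum_comm]
  refine Finset.sum_congr rfl fun i _ => Finset.sum_congr rfl fun j _ => ?_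
  rw [show A j i = A i j from by simpa using congrFun (congrFun hA i) j]

/-- `∇*A∇` kills the constants. [cite: AdamsBuchholzKoteckyMuller2019, Ch. 6.1] -/
theorem ellMat_mulVec_const (A : Matrix (Fin d) (Fin d) ℝ) (c : ℝ) :
    ellMat A *ᵥ (fun _ : Fin d → ZMod M => c) = 0 := by
  rw [ellMat_mulVec]
  funext x
  simp [ellOp, GradientFRD.bwdDiff, GradientFRD.fwdDiff]

/-- `∇*A∇` is blind to constant shifts. [cite: AdamsBuchholzKoteckyMuller2019, Ch. 6.1] -/
theorem ellMat_mulVec_add_const (A : Matrix (Fin d) (Fin d) ℝ) (φ : (Fin d → ZMod M) → ℝ) (c : ℝ) :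
    ellMat A *ᵥ (φ + fun _ => c) = ellMat A *ᵥ φ := by
  rw [Matrix.mulVec_add, ellMat_mulVec_const, add_zero]

/-! ## The zero-mode matrix `c𝟙𝟙ᵀ` -/

/-- `constMat c · v = (c Σ_x v(x)) 𝟙`. [cite: AdamsBuchholzKoteckyMuller2019, Lemma 6.3] -/
theorem constMat_mulVec (c : ℝ) (v : (Fin d → ZMod M) → ℝ) :
    constMat c *ᵥ v = fun _ => c * ∑ x, v x := by
  funext x
  simp [constMat, Matrix.mulVec, dotProduct, Finset.mul_sum]

/-- `constMat a · constMat b = constMat (a b |Λ|)`. [cite: AdamsBuchholzKoteckyMuller2019, Lemma 6.3] -/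
theorem constMat_mul_constMat (a b : ℝ) :
    constMat (Λ := Fin d → ZMod M) a * constMat b = constMat (a * b * Fintype.card (Fin d → ZMod M)) := by
  ext x y
  simp [constMat, Matrix.mul_apply, Finset.sum_const, Finset.card_univ]
  ring

/-- A zero-sum kernel's convolution operator kills `c𝟙𝟙ᵀ`: `circulant 𝒞 · constMat c = 0`.
[cite: AdamsBuchholzKoteckyMuller2019, Theorem 6.1 (i)] -/
theorem circulant_mul_constMat {𝒞 : (Fin d → ZMod M) → ℝ} (h0 : ∑ x, 𝒞 x = 0) (c : ℝ) :
    Matrix.circulant 𝒞 * constMat c = 0 := by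
  ext x y
  have h := congrFun (circulant_mulVec_const' h0 c) x
  simp only [Matrix.mulVec, dotProduct, Pi.zero_apply] at h
  simpa [Matrix.mul_apply, constMat] using h

/-- `constMat c · ellMat A = 0` for symmetric `A`. [cite: AdamsBuchholzKoteckyMuller2019, Ch. 6.1] -/
theorem constMat_mul_ellMat {A : Matrix (Fin d) (Fin d) ℝ} (hA : A.IsSymm) (c : ℝ) :
    constMat c * ellMat (M := M) A = 0 := by
  ext x y
  have h := congrFun (ellMat_mulVec_const (M := M) A (1 : ℝ)) y
  rw [← ellMat_transpose hA] at h
  simp only [Matrix.mulVec, dotProduct, Matrix.transpose_apply, mul_one, Pi.zero_apply] at h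
  simp only [Matrix.mul_apply, constMat, Matrix.of_apply, Matrix.zero_apply]
  rw [← Finset.mul_sum, h, mul_zero]

/-! ## The precision of the regularised Green's function -/

section Precision

variable {A : Matrix (Fin d) (Fin d) ℝ} {𝒞 : (Fin d → ZMod M) → ℝ}

/-- **`(∇*A∇) · circulant 𝒞 = 1 − 𝟙𝟙ᵀ/|Λ|`** when `Σ𝒞 = 0` and `∇*A∇(𝒞 ⋆ φ) = φ` on zero-average fields
(clauses (o), (ii) of `GradientFRD.TorusFRD` for the total kernel).
[cite: AdamsBuchholzKoteckyMuller2019, Theorem 6.1 (ii)] -/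
theorem ellMat_mul_circulant (h0 : ∑ x, 𝒞 x = 0)
    (hinv : ∀ φ : (Fin d → ZMod M) → ℝ, ∑ x, φ x = 0 → ellOp A (GradientFRD.conv 𝒞 φ) = φ) :
    ellMat A * Matrix.circulant 𝒞 =
      1 - constMat ((Fintype.card (Fin d → ZMod M) : ℝ)⁻¹) := by
  set N : ℝ := (Fintype.card (Fin d → ZMod M) : ℝ) with hN
  have hN0 : N ≠ 0 := by rw [hN]; exact_mod_cast Fintype.card_ne_zero
  refine Matrix.ext_iff_mulVec.2 fun v => ?_
  set c : ℝ := (∑ x, v x) / N with hc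
  set w : (Fin d → ZMod M) → ℝ := v - fun _ => c with hw
  have hw0 : ∑ x, w x = 0 := by
    simp only [hw, Pi.sub_apply, Finset.sum_sub_distrib, Finset.sum_const, Finset.card_univ, nsmul_eq_mul]
    rw [hc]; field_simp; ring
  have hv : v = w + fun _ => c := by rw [hw, sub_add_cancel]
  have hconv : GradientFRD.conv 𝒞 w = Matrix.circulant 𝒞 *ᵥ w := by
    funext x; simp [GradientFRD.conv, Matrix.mulVec, dotProduct, Matrix.circulant_apply]
  rw [← Matrix.mulVec_mulVec, hv, Matrix.mulVec_add, circulant_mulVec_const' h0, add_zero, ← hconv,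
    ellMat_mulVec, hinv w hw0, Matrix.sub_mulVec, Matrix.one_mulVec, constMat_mulVec]
  funext x
  simp only [Pi.add_apply, Pi.sub_apply, Finset.sum_add_distrib, Finset.sum_const, Finset.card_univ,
    nsmul_eq_mul, hw0, zero_add]
  rw [← hN, hc]
  field_simp
  ring

/-- **`circulant 𝒞 · (∇*A∇) = 1 − 𝟙𝟙ᵀ/|Λ|`** (transpose of `ellMat_mul_circulant`; `A` symmetric, `𝒞` even).
[cite: AdamsBuchholzKoteckyMuller2019, Theorem 6.1 (ii)] -/
theorem circulant_mul_ellMat (hA : A.IsSymm) (h0 : ∑ x, 𝒞 x = 0) (heven : ∀ x, 𝒞 (-x) = 𝒞 x)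
    (hinv : ∀ φ : (Fin d → ZMod M) → ℝ, ∑ x, φ x = 0 → ellOp A (GradientFRD.conv 𝒞 φ) = φ) :
    Matrix.circulant 𝒞 * ellMat A =
      1 - constMat ((Fintype.card (Fin d → ZMod M) : ℝ)⁻¹) := by
  have h := congrArg Matrix.transpose (ellMat_mul_circulant h0 hinv)
  have hcirc : (Matrix.circulant 𝒞)ᵀ = Matrix.circulant 𝒞 := by
    rw [Matrix.transpose_circulant]
    exact congrArg Matrix.circulant (funext heven)
  have hone : ((1 : Matrix (Fin d → ZMod M) (Fin d → ZMod M) ℝ) -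
      constMat ((Fintype.card (Fin d → ZMod M) : ℝ)⁻¹))ᵀ =
      1 - constMat ((Fintype.card (Fin d → ZMod M) : ℝ)⁻¹) := by
    rw [Matrix.transpose_sub, Matrix.transpose_one]
    congr 1
  rwa [Matrix.transpose_mul, ellMat_transpose hA, hcirc, hone] at h

/-- **`(circulant 𝒞 + c𝟙𝟙ᵀ) · (∇*A∇ + 𝟙𝟙ᵀ/(c|Λ|²)) = 1`** (`c ≠ 0`).
[cite: AdamsBuchholzKoteckyMuller2019, Ch. 4.2 (4.5)–(4.8) / Lemma 6.3] -/
theorem circulant_add_constMat_mul (hA : A.IsSymm) (h0 : ∑ x, 𝒞 x = 0) (heven : ∀ x, 𝒞 (-x) = 𝒞 x)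
    (hinv : ∀ φ : (Fin d → ZMod M) → ℝ, ∑ x, φ x = 0 → ellOp A (GradientFRD.conv 𝒞 φ) = φ) {c : ℝ} (hc : c ≠ 0) :
    (Matrix.circulant 𝒞 + constMat c) *
        (ellMat A + constMat (c⁻¹ * ((Fintype.card (Fin d → ZMod M) : ℝ) ^ 2)⁻¹)) = 1 := by
  have hN0 : (Fintype.card (Fin d → ZMod M) : ℝ) ≠ 0 := by exact_mod_cast Fintype.card_ne_zero
  rw [Matrix.add_mul, Matrix.mul_add, Matrix.mul_add, circulant_mul_ellMat hA h0 heven hinv,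
    circulant_mul_constMat h0, constMat_mul_ellMat hA, constMat_mul_constMat,
    show c * (c⁻¹ * ((Fintype.card (Fin d → ZMod M) : ℝ) ^ 2)⁻¹) * (Fintype.card (Fin d → ZMod M) : ℝ) =
      ((Fintype.card (Fin d → ZMod M) : ℝ))⁻¹ from by field_simp]
  abel

/-- **The precision of the regularised Green's function**:
`(circulant 𝒞 + c𝟙𝟙ᵀ)⁻¹ = ∇*A∇ + 𝟙𝟙ᵀ/(c|Λ|²)`. [cite: AdamsBuchholzKoteckyMuller2019, Ch. 4.2 (4.5)–(4.8) / Lemma 6.3] -/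
theorem inv_circulant_add_constMat (hA : A.IsSymm) (h0 : ∑ x, 𝒞 x = 0) (heven : ∀ x, 𝒞 (-x) = 𝒞 x)
    (hinv : ∀ φ : (Fin d → ZMod M) → ℝ, ∑ x, φ x = 0 → ellOp A (GradientFRD.conv 𝒞 φ) = φ) {c : ℝ} (hc : c ≠ 0) :
    (Matrix.circulant 𝒞 + constMat c)⁻¹ =
      ellMat A + constMat (c⁻¹ * ((Fintype.card (Fin d → ZMod M) : ℝ) ^ 2)⁻¹) :=
  Matrix.inv_eq_right_inv (circulant_add_constMat_mul hA h0 heven hinv hc)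

/-- **The regularised Green's function is positive definite** (`c > 0`): `circulant 𝒞 ⪰ 0` and its
kernel meets the zero-average fields only in `0` (by (ii)), while `c𝟙𝟙ᵀ` charges the mean.
[cite: AdamsBuchholzKoteckyMuller2019, Lemma 6.3] -/
theorem posDef_circulant_add_constMat_of_inv (hC : (Matrix.circulant 𝒞).PosSemidef)
    (hinv : ∀ φ : (Fin d → ZMod M) → ℝ, ∑ x, φ x = 0 → ellOp A (GradientFRD.conv 𝒞 φ) = φ) {c : ℝ} (hc : 0 < c) :
    (Matrix.circulant 𝒞 + constMat c).PosDef := by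
  have hJ : (constMat (Λ := Fin d → ZMod M) c).PosSemidef := posSemidef_constMat hc.le
  refine Matrix.PosDef.of_dotProduct_mulVec_pos (hC.1.add hJ.1) fun v hv => ?_
  have h1 : 0 ≤ star v ⬝ᵥ Matrix.circulant 𝒞 *ᵥ v := hC.dotProduct_mulVec_nonneg v
  have h2 : 0 ≤ star v ⬝ᵥ constMat c *ᵥ v := hJ.dotProduct_mulVec_nonneg v
  rw [Matrix.add_mulVec, dotProduct_add]
  rcases (add_nonneg h1 h2).lt_or_eq with h | h
  · exact h
  · exfalso
    have h1' : star v ⬝ᵥ Matrix.circulant 𝒞 *ᵥ v = 0 := le_antisymm (by linarith) h1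
    have h2' : star v ⬝ᵥ constMat c *ᵥ v = 0 := le_antisymm (by linarith) h2
    have hker : Matrix.circulant 𝒞 *ᵥ v = 0 := (hC.dotProduct_mulVec_zero_iff v).1 h1'
    have hsum : ∑ x, v x = 0 := by
      rw [star_trivial, constMat_mulVec] at h2'
      simp only [dotProduct, ← Finset.sum_mul] at h2'
      have : c * (∑ x, v x) ^ 2 = 0 := by rw [← h2']; ring
      rcases mul_eq_zero.1 this with h | h
      · exact absurd h hc.ne'
      · exact pow_eq_zero_iff two_ne_zero |>.1 h
    have hconv : GradientFRD.conv 𝒞 v = Matrix.circulant 𝒞 *ᵥ v := by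
      funext x; simp [GradientFRD.conv, Matrix.mulVec, dotProduct, Matrix.circulant_apply]
    have := hinv v hsum
    rw [hconv, hker] at this
    apply hv
    rw [← this, ← ellMat_mulVec, Matrix.mulVec_zero]

end Precision

/-! ## The change-of-form identity -/

/-- **The normalisation ratio `κ_{A,A'} = Z_{A'}/Z_A`** of the two regularised precisions
`∇*A∇ + 𝟙𝟙ᵀ/|Λ|²`, `∇*A'∇ + 𝟙𝟙ᵀ/|Λ|²` (as a real number; positive by `formChangeConst_pos`).
[cite: AdamsBuchholzKoteckyMuller2019, Ch. 4.2 (4.7) (the factor Z^{(q)}/Z^{(0)})] -/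
def formChangeConst (A A' : Matrix (Fin d) (Fin d) ℝ) : ℝ :=
  (gaussZ (ellMat (M := M) A' + constMat (((Fintype.card (Fin d → ZMod M) : ℝ) ^ 2)⁻¹)) *
    (gaussZ (ellMat (M := M) A + constMat (((Fintype.card (Fin d → ZMod M) : ℝ) ^ 2)⁻¹)))⁻¹).toReal

section FormChange

variable {A A' : Matrix (Fin d) (Fin d) ℝ} {𝒞 𝒞' : (Fin d → ZMod M) → ℝ}

/-- The regularisation at `c = 1`: `(circulant 𝒞 + 𝟙𝟙ᵀ)⁻¹ = ∇*A∇ + 𝟙𝟙ᵀ/|Λ|²`.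
[cite: AdamsBuchholzKoteckyMuller2019, Ch. 4.2 (4.5)–(4.8)] -/
theorem inv_circulant_add_constMat_one (hA : A.IsSymm) (h0 : ∑ x, 𝒞 x = 0) (heven : ∀ x, 𝒞 (-x) = 𝒞 x)
    (hinv : ∀ φ : (Fin d → ZMod M) → ℝ, ∑ x, φ x = 0 → ellOp A (GradientFRD.conv 𝒞 φ) = φ) :
    (Matrix.circulant 𝒞 + constMat 1)⁻¹ =
      ellMat A + constMat (((Fintype.card (Fin d → ZMod M) : ℝ) ^ 2)⁻¹) := by
  rw [inv_circulant_add_constMat hA h0 heven hinv one_ne_zero, inv_one, one_mul]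

/-- **`κ_{A,A'} > 0`** whenever both coefficient matrices carry a finite-range decomposition
(clauses (o)–(ii)). [cite: AdamsBuchholzKoteckyMuller2019, Ch. 4.2 (4.7)] -/
theorem formChangeConst_pos (hA : A.IsSymm) (hA' : A'.IsSymm)
    (h0 : ∑ x, 𝒞 x = 0) (hC : (Matrix.circulant 𝒞).PosSemidef)
    (hinv : ∀ φ : (Fin d → ZMod M) → ℝ, ∑ x, φ x = 0 → ellOp A (GradientFRD.conv 𝒞 φ) = φ)
    (h0' : ∑ x, 𝒞' x = 0) (hC' : (Matrix.circulant 𝒞').PosSemidef)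
    (hinv' : ∀ φ : (Fin d → ZMod M) → ℝ, ∑ x, φ x = 0 → ellOp A' (GradientFRD.conv 𝒞' φ) = φ) :
    0 < formChangeConst (M := M) A A' := by
  have heven : ∀ x, 𝒞 (-x) = 𝒞 x := fun x => by
    have h := hC.1
    unfold Matrix.IsHermitian at h
    rw [Matrix.conjTranspose_eq_transpose_of_trivial, Matrix.transpose_circulant] at h
    simpa [Matrix.circulant_apply] using congrFun (congrFun h x) 0
  have heven' : ∀ x, 𝒞' (-x) = 𝒞' x := fun x => by
    have h := hC'.1
    unfold Matrix.IsHermitian at h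
    rw [Matrix.conjTranspose_eq_transpose_of_trivial, Matrix.transpose_circulant] at h
    simpa [Matrix.circulant_apply] using congrFun (congrFun h x) 0
  have hS := posDef_circulant_add_constMat_of_inv hC hinv one_pos
  have hS' := posDef_circulant_add_constMat_of_inv hC' hinv' one_pos
  obtain ⟨-, hZ0, hZt⟩ := multivariateGaussian_eq_withDensity hS
  obtain ⟨-, hZ0', hZt'⟩ := multivariateGaussian_eq_withDensity hS'
  rw [inv_circulant_add_constMat_one hA h0 heven hinv] at hZ0 hZt
  rw [inv_circulant_add_constMat_one hA' h0' heven' hinv'] at hZ0' hZt'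
  unfold formChangeConst
  refine ENNReal.toReal_pos (mul_ne_zero hZ0' (ENNReal.inv_ne_zero.2 hZt)) ?_
  exact ENNReal.mul_ne_top hZt' (ENNReal.inv_ne_top.2 hZ0)

/-- **Change of the quadratic form of the torus Gaussian on gradient functionals** ([ABKM19] (4.5)–(4.8)):
for symmetric `A, A'`, total kernels `𝒞, 𝒞'` with zero sum, `circulant ⪰ 0`, and `∇*A∇(𝒞⋆φ) = φ`,
`∇*A'∇(𝒞'⋆φ) = φ` on zero-average fields, and every strongly measurable shift-invariant `F`:
`∫ F d(stepMeasure 𝒞) = κ_{A,A'} • ∫ e^{½ Σ_x Σ_{ij}(A'−A)_{ij}∇_iφ(x)∇_jφ(x)} • F(φ) d(stepMeasure 𝒞')`.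
[cite: AdamsBuchholzKoteckyMuller2019, Ch. 4.2 (4.5)–(4.8)] -/
theorem integral_stepMeasure_eq_formChange (hA : A.IsSymm) (hA' : A'.IsSymm)
    (h0 : ∑ x, 𝒞 x = 0) (hC : (Matrix.circulant 𝒞).PosSemidef)
    (hinv : ∀ φ : (Fin d → ZMod M) → ℝ, ∑ x, φ x = 0 → ellOp A (GradientFRD.conv 𝒞 φ) = φ)
    (h0' : ∑ x, 𝒞' x = 0) (hC' : (Matrix.circulant 𝒞').PosSemidef)
    (hinv' : ∀ φ : (Fin d → ZMod M) → ℝ, ∑ x, φ x = 0 → ellOp A' (GradientFRD.conv 𝒞' φ) = φ)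
    {E : Type*} [NormedAddCommGroup E] [NormedSpace ℝ E]
    {F : ((Fin d → ZMod M) → ℝ) → E} (hF : StronglyMeasurable F)
    (hFinv : ∀ (φ : (Fin d → ZMod M) → ℝ) (a : ℝ), F (φ + fun _ => a) = F φ) :
    ∫ ξ, F ξ ∂(stepMeasure 𝒞) =
      formChangeConst (M := M) A A' •
        ∫ ξ, Real.exp ((∑ x, ∑ i, ∑ j, (A' - A) i j * GradientFRD.fwdDiff i ξ x * GradientFRD.fwdDiff j ξ x) / 2) • F ξ
          ∂(stepMeasure 𝒞') := by
  have heven : ∀ x, 𝒞 (-x) = 𝒞 x := fun x => by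
    have h := hC.1
    unfold Matrix.IsHermitian at h
    rw [Matrix.conjTranspose_eq_transpose_of_trivial, Matrix.transpose_circulant] at h
    simpa [Matrix.circulant_apply] using congrFun (congrFun h x) 0
  have heven' : ∀ x, 𝒞' (-x) = 𝒞' x := fun x => by
    have h := hC'.1
    unfold Matrix.IsHermitian at h
    rw [Matrix.conjTranspose_eq_transpose_of_trivial, Matrix.transpose_circulant] at h
    simpa [Matrix.circulant_apply] using congrFun (congrFun h x) 0
  set S := Matrix.circulant 𝒞 + constMat (1 : ℝ) with hSdef
  set S' := Matrix.circulant 𝒞' + constMat (1 : ℝ) with hS'def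
  have hS : S.PosDef := posDef_circulant_add_constMat_of_inv hC hinv one_pos
  have hS' : S'.PosDef := posDef_circulant_add_constMat_of_inv hC' hinv' one_pos
  have hSinv : S⁻¹ = ellMat A + constMat (((Fintype.card (Fin d → ZMod M) : ℝ) ^ 2)⁻¹) :=
    inv_circulant_add_constMat_one hA h0 heven hinv
  have hS'inv : S'⁻¹ = ellMat A' + constMat (((Fintype.card (Fin d → ZMod M) : ℝ) ^ 2)⁻¹) :=
    inv_circulant_add_constMat_one hA' h0' heven' hinv'
  -- the weight `e^{½⟨∇φ,(A'−A)∇φ⟩}` is continuous and shift invariant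
  set G : ((Fin d → ZMod M) → ℝ) → E := fun ξ =>
    Real.exp ((∑ x, ∑ i, ∑ j, (A' - A) i j * GradientFRD.fwdDiff i ξ x * GradientFRD.fwdDiff j ξ x) / 2) • F ξ with hGdef
  have hD : ∀ (i : Fin d) (x : Fin d → ZMod M), Continuous fun ξ : (Fin d → ZMod M) → ℝ => GradientFRD.fwdDiff i ξ x :=
    fun i x => by unfold GradientFRD.fwdDiff; fun_prop
  have hwc : Continuous fun ξ : (Fin d → ZMod M) → ℝ =>
      Real.exp ((∑ x, ∑ i, ∑ j, (A' - A) i j * GradientFRD.fwdDiff i ξ x * GradientFRD.fwdDiff j ξ x) / 2) := by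
    refine Real.continuous_exp.comp (Continuous.div_const ?_ _)
    refine continuous_finsetSum _ fun x _ => continuous_finsetSum _ fun i _ =>
      continuous_finsetSum _ fun j _ => ?_
    exact (continuous_const.mul (hD i x)).mul (hD j x)
  have hG : StronglyMeasurable G := hwc.stronglyMeasurable.smul hF
  have hshift : ∀ (i : Fin d) (ξ : (Fin d → ZMod M) → ℝ) (a : ℝ), GradientFRD.fwdDiff i (ξ + fun _ => a) = GradientFRD.fwdDiff i ξ := by
    intro i ξ a; funext x; simp [GradientFRD.fwdDiff]
  have hGinv : ∀ (φ : (Fin d → ZMod M) → ℝ) (a : ℝ), G (φ + fun _ => a) = G φ := by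
    intro φ a
    simp only [hGdef, hshift, hFinv]
  -- step 1: regularise `stepMeasure 𝒞` by the zero mode
  rw [integral_stepMeasure_eq_integral_multivariateGaussian_add_constMat hC zero_le_one hF hFinv]
  -- step 2: change of measure `N(0,S) = gaussRatio S' S · N(0,S')`
  rw [← hSdef, multivariateGaussian_eq_withDensity_gaussRatio hS' hS]
  obtain ⟨-, hZ0, hZt⟩ := multivariateGaussian_eq_withDensity hS
  obtain ⟨-, hZ0', hZt'⟩ := multivariateGaussian_eq_withDensity hS'
  have hlt : ∀ᵐ y ∂(multivariateGaussian (0 : EuclideanSpace ℝ (Fin d → ZMod M)) S'), gaussRatio S' S y < ⊤ := by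
    refine Filter.Eventually.of_forall fun y => ?_
    unfold gaussRatio
    exact ENNReal.mul_lt_top (ENNReal.mul_lt_top hZt'.lt_top (ENNReal.inv_lt_top.2 hZ0.bot_lt))
      ENNReal.ofReal_lt_top
  rw [integral_withDensity_eq_integral_toReal_smul (measurable_gaussRatio _ _) hlt]
  -- the density ratio is `κ · e^{½⟨∇ψ,(A'−A)∇ψ⟩}`
  have hratio : ∀ y : EuclideanSpace ℝ (Fin d → ZMod M), (gaussRatio S' S y).toReal • F (ofLp y) =
      formChangeConst (M := M) A A' • G (ofLp y) := by
    intro y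
    rw [toReal_gaussRatio, hSinv, hS'inv, add_sub_add_right_eq_sub, ellMat_sub, dotProduct_ellMat_mulVec,
      hGdef, smul_smul]
    rfl
  simp_rw [hratio]
  rw [integral_smul]
  -- step 3: un-regularise for `𝒞'`
  rw [← integral_stepMeasure_eq_integral_multivariateGaussian_add_constMat hC' zero_le_one hG hGinv]

end FormChange

end Literature.MathematicalPhysics.StatisticalMechanics.GradientRG

end
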